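import Mathlib
import Summits.ValiantsHypothesis.ValiantsHypothesis.Theses.NewtonUnitEquations
import Summits.ValiantsHypothesis.ValiantsHypothesis.Theorems.NewtonTauWeak.Negative.Zonogon

/-!
# Sketch (crux-strategist, stmt-5904): the HALVING form of aligned peeling — a ready-made line for the RETARGETED
# crux `NewtonTauQuasi` (not registrable on `NewtonTauWeak`: it concludes the quasi bound, not the weak one)

`HalvingAligned p q`: for two `k`-tuples of level-`ℓ` products `G_i = Π_j g_ij`, `H_i = Π_j h_ij` of `t`-sparse factors with
aligned-combination bounds `V_g`, `V_h`,  `vert(Σ_i G_i H_i) ≤ (k+2)^p (V_g + V_h) + (k t + 2)^q`.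
A `poly(k)` multiplicative loss per HALVING level is affordable for the quasi target
(`T(2ℓ) ≤ 2(k+2)^p T(ℓ) + (kt+2)^q ⇒ T(m) ≤ (2(k+2)^p)^{⌈log₂ m⌉}(k t + (kt+2)^q)`), whereas the weak target needs an
ABSOLUTE constant per (sequential) level (`Lines/aligned_peeling.lean`).  The dissociated case of `HalvingAligned` is, up to
the dictionary "aligned count ↔ greedy shadow", the landed product step of Theorem Q
(`QuasiPoly.ncard_fshadow_add_le`: `s(n₁+n₂) ≤ 2k²(k s(n₁) + k s(n₂) + 1) + 2k + 1`).
Statements elaborate; the induction `newtonTauQuasi_of_halvingAligned` is left as a `sorry` (M-sized, same bookkeeping as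
`stub_peelInduction` with `Fin (ℓ + ℓ)` splitting via `Fin.prod_univ_add` and padding `m` to a power of two with factors `1`).
-/

set_option linter.dupNamespace false

namespace Summit.ValiantsHypothesis.ValiantsHypothesis.Cruxes.NewtonTauWeak.QuasiHalving

open scoped BigOperators
open MvPolynomial
open Summit.ValiantsHypothesis.ValiantsHypothesis.Theorems.NewtonTauWeak.Negative (vert)

noncomputable section

/-- Aligned-combination bound (as in line `aligned-peeling`). -/
def AlignedBound {k ℓ : ℕ} (g : Fin k → Fin ℓ → MvPolynomial (Fin 2) ℂ) (V : ℕ) : Prop :=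
  ∀ (a : Fin k → (Fin 2 →₀ ℕ)) (d : Fin k → ℂ), vert (∑ i, monomial (a i) (d i) * ∏ j, g i j) ≤ V

/-- HALVING ALIGNED PEELING with a `poly(k)` multiplicative loss. -/
def HalvingAligned (p q : ℕ) : Prop :=
  ∀ (k ℓ t Vg Vh : ℕ) (g h : Fin k → Fin ℓ → MvPolynomial (Fin 2) ℂ),
    (∀ i j, (g i j).support.card ≤ t) → (∀ i j, (h i j).support.card ≤ t) →
    AlignedBound g Vg → AlignedBound h Vh →
      vert (∑ i, (∏ j, g i j) * (∏ j, h i j)) ≤ (k + 2) ^ p * (Vg + Vh) + (k * t + 2) ^ q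

/-- The quasi target (Theorem-Q shape; KPTT's printed Thm 1 hypothesis with `c < 2` is met by it). -/
def NewtonTauQuasi : Prop :=
  ∃ a b : ℕ, ∀ (k m t : ℕ) (f : Fin k → Fin m → MvPolynomial (Fin 2) ℂ),
    (∀ i j, (f i j).support.card ≤ t) →
      vert (∑ i, ∏ j, f i j) ≤ 2 ^ (a * m) * (k * t + 2) ^ (b * Nat.clog 2 (m + 2))

/-- The halving induction (sketch; `sorry`): `HalvingAligned p q` for some `p q` gives the quasi target. -/
theorem newtonTauQuasi_of_halvingAligned (h : ∃ p q : ℕ, HalvingAligned p q) : NewtonTauQuasi := by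
  sorry

end

end Summit.ValiantsHypothesis.ValiantsHypothesis.Cruxes.NewtonTauWeak.QuasiHalving
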